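import Summits.QuantumFields.YangMills.Theorems.F4SubCurvatureDoorHexagonPolynomialHigh
import Summits.QuantumFields.YangMills.Theorems.F4SubCurvatureDoorHexagonPolynomialDegenerate
import Summits.QuantumFields.YangMills.Theorems.F4SubCurvatureDoorHexagonPolynomialCubicCase
import Summits.QuantumFields.YangMills.Theorems.F4SubCurvatureDoorHexagonCubic
import Mathlib
import HarnessLib

/-!
# Hexagon normal form — NO POLYNOMIAL PAIR PASSES THE HEXAGON WICK TEST (assembly)

Support theorem toward the OPEN finite-type hexagon conjecture behind crux `stmt-QuantumFields-23125`
(`F4SubCurvatureDoor.RationalToGeneral`): the route's CHEAPEST FALSIFIER («a finite-type shell function passing the hexagon Wick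
test») does not exist in the POLYNOMIAL class.

* `wickHexagon_poly_eq_zero` — for real polynomials `F, G`: `WickHexagon F G → G = 0`.  Case split on `deg F` versus `deg G + 3`:
  `<` (`hexagonPencil_noPoly_lt`, p675022), `>` (`hexagonPencil_noPoly_gt`, p675470), `=` degenerate (`hexagonPencil_noPoly_degenerate`,
  p675570), `=` non-degenerate (`hexagonPencil_cubic_limit`, p675710, + the hexagon cubic lemma `hexagonCubicProduct_not_wick`, HOME l15/HexagonCubic.lean ported by seat sfw-p2-w4, p675882).
* `finiteTypeHexagon_poly` — hence the conclusion of `FiniteTypeHexagon` for polynomial pairs (no growth hypothesis needed).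

Mathlib + tree helpers only; THEOREMS ONLY; no `sorry`.  Nothing about crux 23125, crux 23035, any LADDER-YM rung or the Yang–Mills
mass gap is proved here.  Free-hands seat `ym-line-frs-p2` g10, `--supports stmt-QuantumFields-23125`.
-/

set_option autoImplicit false

open Polynomial

namespace Summit.QuantumFields.YangMills.Cruxes.RationalToGeneral.HexagonNormalForm

/-- **No real polynomial pair passes the hexagon Wick test**: `WickHexagon F G` for real polynomials forces `G = 0`. [folklore] -/
theorem wickHexagon_poly_eq_zero (F G : ℝ[X])
    (hW : WickHexagon (fun z => Polynomial.aeval z F) (fun z => Polynomial.aeval z G)) : G = 0 := by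
  by_contra hG
  rcases lt_trichotomy F.natDegree (G.natDegree + 3) with hlt | heq | hgt
  · exact hexagonPencil_noPoly_lt F G hG hlt hW
  · by_cases hlc : F.leadingCoeff + G.leadingCoeff = 0
    · exact hexagonPencil_noPoly_degenerate F G hG heq hlc hW
    · exact hexagonCubicProduct_not_wick G.leadingCoeff ((F.leadingCoeff + G.leadingCoeff) / G.leadingCoeff) G.natDegree
        (leadingCoeff_ne_zero.2 hG) (div_ne_zero hlc (leadingCoeff_ne_zero.2 hG)) (hexagonPencil_cubic_limit F G hG heq hlc hW)
  · exact hexagonPencil_noPoly_gt F G hG hgt hW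

/-- **The finite-type hexagon conjecture holds in the polynomial class** (conclusion of `FiniteTypeHexagon`, no growth hypothesis). -/
theorem finiteTypeHexagon_poly (F G : ℝ[X])
    (hW : WickHexagon (fun z => Polynomial.aeval z F) (fun z => Polynomial.aeval z G)) :
    ∀ z : ℂ, Polynomial.aeval z G = 0 := by
  intro z; rw [wickHexagon_poly_eq_zero F G hW, map_zero]

end Summit.QuantumFields.YangMills.Cruxes.RationalToGeneral.HexagonNormalForm
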